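import Summits.AtomisticToContinuum.Crystallization.Theorems.PalmUnimodularRigidityUnimodularEnergyLowerBound
import Summits.AtomisticToContinuum.Crystallization.Theorems.PalmUnimodularRigidityMinimiserShellsEnergyFloorC
import Summits.AtomisticToContinuum.Crystallization.Theorems.PalmUnimodularRigidityMinimiserShellsMuGSCBasics
import Summits.AtomisticToContinuum.Crystallization.Theorems.ThreeConeCertificateSlackRigidityLawSelection

/-!
# No dust: minimising point-stationary hard-core Lennard-Jones laws charge no finite cluster

Helper file (`--supports stmt-AtomisticToContinuum-6076`) for the registered stub
`stub_minimisingLawsChargeFLC` (the law-level content) of the line `registered` of the crux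
`Summit.AtomisticToContinuum.Crystallization.Theses.HolmgrenBoyleLind.GroundStatesChargeFLCEquilibrium`
(item stmt-AtomisticToContinuum-6076, route `HolmgrenBoyleLind`).  The stub quantifies over the
MINIMISING POINT-STATIONARY HARD-CORE PROBABILITY LAWS `P` on rooted configurations of `ℝ³`
(`δ`-hard-core a.s., Mecke identity, `E_P[h] ≤ e* = ⨅_Q e_LJ(Q)`) and asks that `P` charge the
patches of one relatively dense FLC set; its cohesion half (Blanc–Lewin 2015, §2.2) begins with the
exclusion of DUST, which is what this file certifies:

* inputs from the tree: the STRICT finite-`n` floor `e* < E(n)/n` for every `n ≥ 1`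
  (`SlackRigidityLawSelection.lt_excessRate`: periodisation `2n·e* ≤ E(2n)` and strict binding
  `E(2n) < 2 E(n)`), `e* < 0` (`VolumeGrowth.Basics.eStar_neg`), the proved Palm floor `e_uni ≥ e*`
  (item 9229, `unimodularEnergyLowerBound_proof`), invariant conditioning
  (`meanRootEnergy_cond_le_of_minimising`) and the measurable root energy `rootEnergy'`.
* `groundStateEnergy_le_sum_rootEnergy` — re-rooting a finite configuration `T` at each of its
  points and summing the root energies gives its total energy, `≥ E(#T)`.
* `div_le_meanRootEnergy_of_card` — **uniform rooting inside finite clusters**: a point-stationary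
  probability law a.s. carried by rooted hard-core configurations with exactly `n` points has mean
  root energy `≥ E(n)/n` (Mecke identity with the transport `g(μ, y) = h(μ) + C_δ`: the root sends
  its shifted energy to every point, and receives the shifted energies of all re-rootings, whose sum
  is the total energy of the cluster).
* `ae_measure_univ_eq_top` — **NO DUST**: under a minimising point-stationary `δ`-hard-core
  probability law, almost surely the configuration is INFINITE (`μ univ = ∞`).  Proof: the event
  "exactly `n` points" is measurable and re-rooting invariant; if it had positive probability, the
  conditioned law would again be minimising and carried by `n`-point clusters, whence
  `E(n)/n ≤ e* < E(n)/n`.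
* `ae_exists_infinite` (the carrier set is infinite) and `noDust` — the same statement in the RAW
  frame of the stub (hypotheses of `stub_minimisingLawsChargeFLC` verbatim), the registered sub-goal.
* `ae_forall_exists_atom_lt_norm`, `ae_forall_measure_compl_closedBall_ne_zero`, `noDustUnbounded` —
  metric forms: a.s. atoms beyond every radius; minimising laws charge no bounded configuration.

All `[folklore]` (Blanc–Lewin 2015 §1.2 (4)–(6) for the deterministic input; the Palm-side
statement is the mass-transport reading of "finite clusters evaporate nothing but cost surface").
-/

noncomputable section

open MeasureTheory Filter Set
open scoped ENNReal BigOperators Topology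

namespace Summit.AtomisticToContinuum.Crystallization.Theorems.HolmgrenBoyleLindGroundStatesChargeFLCEquilibrium.NoDust

open Literature.Probability.Process
open Literature.MathematicalPhysics.StatisticalMechanics
open Summit.AtomisticToContinuum.Crystallization.Theorems.MinimiserShells.Negative.LoadBearing
  (eStar meanRootEnergy)
open Summit.AtomisticToContinuum.Crystallization.Theorems.MinimiserShells.Negative.Rootedness
  (E3 isPointStationaryLaw_restrict unimodularEnergyLowerBound_iff meanRootEnergy_cond_le_of_minimising)
open Summit.AtomisticToContinuum.Crystallization.Theorems.PalmUnimodularRigidityMinimiserShells.EnergyFloor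
  (rootEnergy' measurable_rootEnergy' rootEnergy'_eq_of_hc rootEnergy'_bounds_of_hc)
open Summit.AtomisticToContinuum.Crystallization.Theorems.PalmUnimodularRigidityMinimiserShells.VolumeGrowth.Basics
  (eStar_neg)
open Summit.AtomisticToContinuum.Crystallization.Theorems.SlackRigidityLawSelection (lt_excessRate)

/-! ## §1 Finite clusters: summing the root energies over all roots -/

/-- **Re-rooting a finite configuration at all its points recovers its energy**: for a finite set
`T ⊂ ℝ³`, `E(#T) ≤ Σ_{y ∈ T} h(count|(T − y))`, where `h = rootEnergy V_LJ` — the right-hand side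
is the interaction energy of (an enumeration of) `T` (`sum_rootEnergy_rooted_lennardJones`).
[folklore] -/
theorem groundStateEnergy_le_sum_rootEnergy (T : Finset E3) :
    groundStateEnergy lennardJones 3 T.card ≤
      ∑ y ∈ T, rootEnergy lennardJones
        ((Measure.count : Measure E3).restrict ((fun z => z - y) '' (T : Set E3))) := by
  classical
  set n := T.card with hn
  set e : (T : Type) ≃ Fin n := Fintype.equivFinOfCardEq (Fintype.card_coe T) with he
  set x : Fin n → E3 := fun k => ((e.symm k : T) : E3) with hx
  have hxinj : Function.Injective x := fun a b hab =>
    e.symm.injective (Subtype.val_injective hab)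
  have hximg : ∀ (y : E3) (hy : y ∈ T), (fun z => z - y) '' (T : Set E3) =
      Set.range fun k => x k - x (e ⟨y, hy⟩) := by
    intro y hy
    ext z
    constructor
    · rintro ⟨t, ht, rfl⟩
      refine ⟨e ⟨t, ht⟩, ?_⟩
      simp [hx]
    · rintro ⟨k, rfl⟩
      refine ⟨x k, (e.symm k).2, ?_⟩
      simp [hx]
  have hsum : ∑ y ∈ T, rootEnergy lennardJones
        ((Measure.count : Measure E3).restrict ((fun z => z - y) '' (T : Set E3))) =
      ∑ i, rootEnergy lennardJones
        ((Measure.count : Measure E3).restrict (Set.range fun k => x k - x i)) := by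
    rw [← Finset.sum_coe_sort T]
    rw [← e.symm.sum_comp]
    refine Finset.sum_congr rfl fun k _ => ?_
    rw [hximg _ (e.symm k).2]
    simp
  rw [hsum, sum_rootEnergy_rooted_lennardJones hxinj]
  exact groundStateEnergy_lennardJones_le hxinj

/-! ## §2 Uniform rooting inside finite clusters (Mecke) -/

/-- **A point-stationary law carried by `n`-point clusters has mean root energy `≥ E(n)/n`.**
Let `Q` be a probability law on rooted configurations of `ℝ³`, a.s. `δ`-hard-core, point-stationary,
and a.s. with exactly `n ≥ 1` points.  Apply the Mecke identity to the transport
`g(μ, y) = h'(μ) + C_δ ≥ 0` (`h'` the measurable root energy, `C_δ = 250/12·δ⁻⁶`): the root sends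
`n (h'(μ) + C_δ)` in total and receives `Σ_{y ∈ μ} (h'(θ_y μ) + C_δ) = 𝓔(μ) + n C_δ ≥ E(n) + n C_δ`
(§1), so `n (E_Q[h] + C_δ) ≥ E(n) + n C_δ`. [folklore] -/
theorem div_le_meanRootEnergy_of_card {δ : ℝ} (hδ : 0 < δ) {n : ℕ} (hn : 0 < n)
    (Q : Measure (Measure E3)) [IsProbabilityMeasure Q]
    (hcore : ∀ᵐ μ ∂Q, IsRootedHardCore δ μ) (hstat : IsPointStationaryLaw Q)
    (hcard : ∀ᵐ μ ∂Q, μ Set.univ = (n : ℝ≥0∞)) :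
    groundStateEnergy lennardJones 3 n / n ≤ meanRootEnergy Q := by
  classical
  set B : ℝ := 250 / 12 * δ⁻¹ ^ 6 with hB
  set G : Measure E3 → ℝ≥0∞ := fun μ => ENNReal.ofReal (rootEnergy' μ + B) with hG
  have hGm : Measurable G := ENNReal.measurable_ofReal.comp (measurable_rootEnergy'.add_const B)
  have hg : Measurable (Function.uncurry fun (μ : Measure E3) (_ : E3) => G μ) :=
    hGm.comp measurable_fst
  -- nonnegativity and identification of `h' + C_δ` on hard-core configurations
  have hnn : ∀ μ : Measure E3, IsRootedHardCore δ μ → 0 ≤ rootEnergy' μ + B := fun μ h => by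
    have := (rootEnergy'_bounds_of_hc hδ h).1
    rw [hB]
    linarith
  -- the Mecke identity for `g`
  have hM := hstat _ hg
  -- left-hand side: `n ∫⁻ G`
  have hL : ∫⁻ μ, ∫⁻ _y, G μ ∂μ ∂Q = n * ∫⁻ μ, G μ ∂Q := by
    have hae : ∀ᵐ μ ∂Q, ∫⁻ _y, G μ ∂μ = n * G μ := hcard.mono fun μ hμ => by
      rw [lintegral_const, hμ, mul_comm]
    rw [lintegral_congr_ae hae, lintegral_const_mul _ hGm]
  -- `∫⁻ G = ofReal (E_Q[h] + C_δ)`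
  have hint : Integrable rootEnergy' Q := by
    refine Integrable.of_bound measurable_rootEnergy'.aestronglyMeasurable
      (max (250 / 12 * δ⁻¹ ^ 6) (250 / 24 * δ⁻¹ ^ 12)) (hcore.mono fun μ h => ?_)
    obtain ⟨h1, h2⟩ := rootEnergy'_bounds_of_hc hδ h
    rw [Real.norm_eq_abs, abs_le]
    constructor
    · exact le_trans (neg_le_neg (le_max_left _ _)) h1
    · exact h2.trans (le_max_right _ _)
  have hmean : meanRootEnergy Q = ∫ μ, rootEnergy' μ ∂Q :=
    integral_congr_ae (hcore.mono fun μ h => (rootEnergy'_eq_of_hc hδ h).symm)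
  have hnnae : 0 ≤ᵐ[Q] fun μ => rootEnergy' μ + B := hcore.mono fun μ h => hnn μ h
  have hint' : Integrable (fun μ => rootEnergy' μ + B) Q := hint.add (integrable_const B)
  have hGint : ∫⁻ μ, G μ ∂Q = ENNReal.ofReal (meanRootEnergy Q + B) := by
    have h1 : ∫ μ, rootEnergy' μ + B ∂Q = meanRootEnergy Q + B := by
      rw [integral_add hint (integrable_const B), integral_const, hmean]
      simp
    rw [← h1, ofReal_integral_eq_lintegral_ofReal hint' hnnae]
  have hmB : 0 ≤ meanRootEnergy Q + B := by
    have h1 : ∫ μ, rootEnergy' μ + B ∂Q = meanRootEnergy Q + B := by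
      rw [integral_add hint (integrable_const B), integral_const, hmean]
      simp
    rw [← h1]
    exact integral_nonneg_of_ae hnnae
  -- right-hand side: `≥ ofReal (E(n) + n C_δ)`
  have hR : ENNReal.ofReal (groundStateEnergy lennardJones 3 n + n * B) ≤
      ∫⁻ μ, ∫⁻ y, G (Measure.map (fun z => z - y) μ) ∂μ ∂Q := by
    have hae : ∀ᵐ μ ∂Q, ENNReal.ofReal (groundStateEnergy lennardJones 3 n + n * B) ≤
        ∫⁻ y, G (Measure.map (fun z => z - y) μ) ∂μ := by
      filter_upwards [hcore, hcard] with μ hc hcd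
      obtain ⟨S, h0, hsep, rfl⟩ := hc
      rw [Measure.restrict_apply_univ] at hcd
      have hSfin : S.Finite := Measure.count_apply_lt_top.1 (by rw [hcd]; exact ENNReal.natCast_lt_top n)
      set T : Finset E3 := hSfin.toFinset with hT
      have hST : (T : Set E3) = S := hSfin.coe_toFinset
      have hTcard : T.card = n := by
        rw [Measure.count_apply_finite S hSfin] at hcd
        exact_mod_cast hcd
      rw [← hST]
      rw [lintegral_finset]
      simp only [Measure.count_singleton, mul_one]
      -- each term is the shifted root energy plus the constant
      have hterm : ∀ y ∈ T, G (Measure.map (fun z => z - y)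
          ((Measure.count : Measure E3).restrict (T : Set E3))) =
            ENNReal.ofReal (rootEnergy lennardJones
              ((Measure.count : Measure E3).restrict ((fun z => z - y) '' (T : Set E3))) + B) ∧
          0 ≤ rootEnergy lennardJones
              ((Measure.count : Measure E3).restrict ((fun z => z - y) '' (T : Set E3))) + B := by
        intro y hy
        have hyS : y ∈ S := by rw [← hST]; exact hy
        have hhc : IsRootedHardCore δ
            ((Measure.count : Measure E3).restrict ((fun z => z - y) '' (T : Set E3))) := by
          refine ⟨(fun z => z - y) '' (T : Set E3), ⟨y, by exact_mod_cast hy, sub_self y⟩, ?_, rfl⟩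
          rintro _ ⟨a, ha, rfl⟩ _ ⟨b, hb, rfl⟩ hne
          rw [dist_sub_right]
          rw [hST] at ha hb
          exact hsep a ha b hb fun hab => hne (by rw [hab])
        have heq : rootEnergy' ((Measure.count : Measure E3).restrict ((fun z => z - y) '' (T : Set E3))) =
            rootEnergy lennardJones
              ((Measure.count : Measure E3).restrict ((fun z => z - y) '' (T : Set E3))) := by
          rw [rootEnergy'_eq_of_hc hδ hhc, rootEnergy_def]
        refine ⟨?_, ?_⟩
        · rw [map_sub_count_restrict, hG]
          simp only
          rw [heq]
        · rw [← heq]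
          exact hnn _ hhc
      rw [Finset.sum_congr rfl fun y hy => (hterm y hy).1,
        ← ENNReal.ofReal_sum_of_nonneg fun y hy => (hterm y hy).2]
      apply ENNReal.ofReal_le_ofReal
      rw [Finset.sum_add_distrib, Finset.sum_const, nsmul_eq_mul, hTcard]
      have := groundStateEnergy_le_sum_rootEnergy T
      rw [hTcard] at this
      linarith
    calc ENNReal.ofReal (groundStateEnergy lennardJones 3 n + n * B)
        = ∫⁻ _μ, ENNReal.ofReal (groundStateEnergy lennardJones 3 n + n * B) ∂Q := by
          rw [lintegral_const, measure_univ, mul_one]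
      _ ≤ _ := lintegral_mono_ae hae
  -- combine
  have key : ENNReal.ofReal (groundStateEnergy lennardJones 3 n + n * B) ≤
      ENNReal.ofReal ((n : ℝ) * (meanRootEnergy Q + B)) := by
    calc ENNReal.ofReal (groundStateEnergy lennardJones 3 n + n * B)
        ≤ ∫⁻ μ, ∫⁻ y, G (Measure.map (fun z => z - y) μ) ∂μ ∂Q := hR
      _ = ∫⁻ μ, ∫⁻ _y, G μ ∂μ ∂Q := hM.symm
      _ = n * ∫⁻ μ, G μ ∂Q := hL
      _ = ENNReal.ofReal ((n : ℝ) * (meanRootEnergy Q + B)) := by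
          rw [hGint, ENNReal.ofReal_mul (Nat.cast_nonneg n), ENNReal.ofReal_natCast]
  have key' := (ENNReal.ofReal_le_ofReal_iff (mul_nonneg (Nat.cast_nonneg n) hmB)).1 key
  have hnr : (0 : ℝ) < n := Nat.cast_pos.2 hn
  rw [div_le_iff₀ hnr]
  rw [mul_add] at key'
  linarith

/-! ## §3 No dust -/

/-- The event "exactly `c` points" is measurable in the Giry σ-algebra. [folklore] -/
theorem measurableSet_setOf_measure_univ_eq (c : ℝ≥0∞) :
    MeasurableSet {μ : Measure E3 | μ Set.univ = c} :=
  (Measure.measurable_coe MeasurableSet.univ) (measurableSet_singleton c)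

/-- Re-rooting preserves the total number of points. [folklore] -/
theorem map_sub_apply_univ (μ : Measure E3) (y : E3) :
    Measure.map (fun z => z - y) μ Set.univ = μ Set.univ := by
  rw [Measure.map_apply (measurable_sub_const y) MeasurableSet.univ, Set.preimage_univ]

/-- **No dust.** Under a minimising (`E_P[h] ≤ e*`) point-stationary `δ`-hard-core probability law
on rooted configurations of `ℝ³`, almost surely the configuration is infinite: `μ univ = ∞`.
For each `n ≥ 1` the invariant event "exactly `n` points", if charged, would condition `P` to a
minimising law (`meanRootEnergy_cond_le_of_minimising` with the proved floor `e_uni ≥ e*`,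
`unimodularEnergyLowerBound_proof`) carried by `n`-point clusters, contradicting
`E(n)/n ≤ E[h] ≤ e* < E(n)/n` (`div_le_meanRootEnergy_of_card`, `lt_excessRate`); `n = 0` is
excluded by the root. [folklore] -/
theorem ae_measure_univ_eq_top {δ : ℝ} (hδ : 0 < δ) (P : Measure (Measure E3))
    [IsProbabilityMeasure P] (hcore : ∀ᵐ μ ∂P, IsRootedHardCore δ μ)
    (hstat : IsPointStationaryLaw P) (hE : meanRootEnergy P ≤ eStar) :
    ∀ᵐ μ ∂P, μ Set.univ = ∞ := by
  have hU := unimodularEnergyLowerBound_iff.1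
    Summit.AtomisticToContinuum.Crystallization.Theorems.unimodularEnergyLowerBound_proof
  set A : ℕ → Set (Measure E3) := fun n => {μ | μ Set.univ = (n : ℝ≥0∞)} with hA
  have hAm : ∀ n, MeasurableSet (A n) := fun n => measurableSet_setOf_measure_univ_eq _
  have hinv : ∀ (n : ℕ) (μ : Measure E3) (y : E3), Measure.map (fun z => z - y) μ ∈ A n ↔ μ ∈ A n := by
    intro n μ y
    simp only [hA, Set.mem_setOf_eq, map_sub_apply_univ]
  -- every `A n` is a null set
  have hnull : ∀ n, P (A n) = 0 := by
    intro n
    rcases Nat.eq_zero_or_pos n with rfl | hn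
    · -- the root is a point: `μ univ ≥ μ {0} = 1`
      refine measure_mono_null ?_ (ae_iff.1 hcore)
      intro μ hμ hc
      have h1 : μ {0} = 1 := hc.measure_zero_singleton
      have h0 : μ Set.univ = 0 := by simpa [hA] using hμ
      have : μ {0} ≤ μ Set.univ := measure_mono (Set.subset_univ _)
      rw [h1, h0] at this
      exact absurd this (by simp)
    · by_contra hpA
      set Q : Measure (Measure E3) := (P (A n))⁻¹ • P.restrict (A n) with hQ
      have hp_top : P (A n) ≠ ⊤ := measure_ne_top P _
      haveI : IsProbabilityMeasure Q := ⟨by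
        rw [hQ, Measure.smul_apply, Measure.restrict_apply MeasurableSet.univ, Set.univ_inter,
          smul_eq_mul, ENNReal.inv_mul_cancel hpA hp_top]⟩
      have hEQ : meanRootEnergy Q ≤ eStar :=
        meanRootEnergy_cond_le_of_minimising eStar_neg hU hδ P hcore hstat hE (hAm n)
          (hinv n) hpA
      have hstatQ : IsPointStationaryLaw Q :=
        (isPointStationaryLaw_restrict hstat (hAm n) (hinv n)).smul _
      have hcoreQ : ∀ᵐ μ ∂Q, IsRootedHardCore δ μ := by
        rw [hQ]
        exact Measure.ae_smul_measure (ae_restrict_of_ae hcore) _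
      have hcardQ : ∀ᵐ μ ∂Q, μ Set.univ = (n : ℝ≥0∞) := by
        rw [hQ]
        exact Measure.ae_smul_measure (ae_restrict_mem (hAm n)) _
      have hlow := div_le_meanRootEnergy_of_card hδ hn Q hcoreQ hstatQ hcardQ
      have hlt := lt_excessRate hn
      linarith
  -- hence a.s. the configuration is in no `A n`, and a hard-core configuration outside all `A n`
  -- is infinite
  have hout : ∀ᵐ μ ∂P, ∀ n : ℕ, μ ∉ A n := by
    rw [ae_all_iff]
    intro n
    exact measure_eq_zero_iff_ae_notMem.1 (hnull n)
  filter_upwards [hcore, hout] with μ hc hn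
  by_contra htop
  obtain ⟨S, -, -, rfl⟩ := hc
  rw [Measure.restrict_apply_univ] at htop
  have hSfin : S.Finite := Measure.count_apply_lt_top.1 (lt_top_iff_ne_top.2 htop)
  refine hn hSfin.toFinset.card ?_
  simp only [hA, Set.mem_setOf_eq, Measure.restrict_apply_univ]
  rw [Measure.count_apply_finite S hSfin]

/-- **No dust, carrier form**: almost surely the configuration is the counting measure of an
INFINITE `δ`-separated set containing the root. [folklore] -/
theorem ae_exists_infinite {δ : ℝ} (hδ : 0 < δ) (P : Measure (Measure E3))
    [IsProbabilityMeasure P] (hcore : ∀ᵐ μ ∂P, IsRootedHardCore δ μ)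
    (hstat : IsPointStationaryLaw P) (hE : meanRootEnergy P ≤ eStar) :
    ∀ᵐ μ ∂P, ∃ S : Set E3, S.Infinite ∧ (0 : E3) ∈ S ∧
      (∀ x ∈ S, ∀ y ∈ S, x ≠ y → δ ≤ dist x y) ∧
      μ = (Measure.count : Measure E3).restrict S := by
  filter_upwards [hcore, ae_measure_univ_eq_top hδ P hcore hstat hE] with μ hc htop
  obtain ⟨S, h0, hsep, rfl⟩ := hc
  refine ⟨S, ?_, h0, hsep, rfl⟩
  rw [Measure.restrict_apply_univ] at htop
  exact Measure.count_apply_eq_top.1 htop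

/-- **No dust, in the raw frame of `stub_minimisingLawsChargeFLC`** (hypotheses verbatim as in
the registered stub of crux stmt-AtomisticToContinuum-6076; registered sub-goal `noDust`): every
minimising point-stationary hard-core probability law on rooted configurations of `ℝ³` is almost
surely carried by infinitely many points.  Definitional unfolding of `ae_measure_univ_eq_top`.
[folklore] -/
theorem noDust :
    ∀ δ : ℝ, 0 < δ → ∀ P : Measure (Measure (EuclideanSpace ℝ (Fin 3))), IsProbabilityMeasure P →
      (∀ᵐ μ ∂P, (∃ S : Set (EuclideanSpace ℝ (Fin 3)), (0 : EuclideanSpace ℝ (Fin 3)) ∈ S ∧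
        (∀ x ∈ S, ∀ y ∈ S, x ≠ y → δ ≤ dist x y) ∧
        μ = (Measure.count : Measure (EuclideanSpace ℝ (Fin 3))).restrict S)) →
      (∀ g : Measure (EuclideanSpace ℝ (Fin 3)) → EuclideanSpace ℝ (Fin 3) → ENNReal,
        Measurable (Function.uncurry g) →
        ∫⁻ μ, ∫⁻ y, g μ y ∂μ ∂P = ∫⁻ μ, ∫⁻ y, g (Measure.map (fun z => z - y) μ) (-y) ∂μ ∂P) →
      (∫ μ, (∫ y, lennardJones ‖y‖ ∂μ) / 2 ∂P) ≤
        (⨅ Q : PeriodicConfiguration 3, Q.energyPerParticle lennardJones) →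
      ∀ᵐ μ ∂P, μ Set.univ = ⊤ := by
  intro δ hδ P hP hcore hstat hE
  exact ae_measure_univ_eq_top hδ P hcore hstat hE

/-! ## §4 Metric forms: minimising laws charge no bounded configuration -/

/-- **No dust, metric form**: under a minimising point-stationary `δ`-hard-core probability law,
almost surely the configuration has atoms beyond every radius — an infinite `δ`-separated set meets
each closed ball in finitely many points (`UnimodularEnergy.finite_inter_closedBall`), so it is
unbounded.  In the language of the stub: the laws it quantifies over charge no bounded (finite)
cluster, the patches they charge at large scales are never those of a finite configuration.
[folklore] -/
theorem ae_forall_exists_atom_lt_norm {δ : ℝ} (hδ : 0 < δ) (P : Measure (Measure E3))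
    [IsProbabilityMeasure P] (hcore : ∀ᵐ μ ∂P, IsRootedHardCore δ μ)
    (hstat : IsPointStationaryLaw P) (hE : meanRootEnergy P ≤ eStar) :
    ∀ᵐ μ ∂P, ∀ R : ℝ, ∃ y : E3, μ {y} ≠ 0 ∧ R < ‖y‖ := by
  filter_upwards [ae_exists_infinite hδ P hcore hstat hE] with μ hμ R
  obtain ⟨S, hinf, -, hsep, rfl⟩ := hμ
  have hfin : (S ∩ Metric.closedBall (0 : E3) R).Finite :=
    Summit.AtomisticToContinuum.Crystallization.Theorems.UnimodularEnergy.finite_inter_closedBall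
      hδ hsep 0 R
  obtain ⟨y, hyS, hyB⟩ := (hinf.sdiff hfin).nonempty
  refine ⟨y, (count_restrict_singleton_ne_zero_iff S y).2 hyS, ?_⟩
  by_contra hle
  exact hyB ⟨hyS, Metric.mem_closedBall.2 (by rwa [dist_zero_right, ← not_lt])⟩

/-- **Minimising laws charge no bounded configuration**: almost surely no ball about the root
carries the whole configuration. [folklore] -/
theorem ae_forall_measure_compl_closedBall_ne_zero {δ : ℝ} (hδ : 0 < δ) (P : Measure (Measure E3))
    [IsProbabilityMeasure P] (hcore : ∀ᵐ μ ∂P, IsRootedHardCore δ μ)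
    (hstat : IsPointStationaryLaw P) (hE : meanRootEnergy P ≤ eStar) :
    ∀ᵐ μ ∂P, ∀ R : ℝ, μ (Metric.closedBall (0 : E3) R)ᶜ ≠ 0 := by
  filter_upwards [ae_forall_exists_atom_lt_norm hδ P hcore hstat hE] with μ hμ R h0
  obtain ⟨y, hy, hR⟩ := hμ R
  have hyc : y ∈ (Metric.closedBall (0 : E3) R)ᶜ := by
    rw [Set.mem_compl_iff, Metric.mem_closedBall, dist_zero_right, not_le]
    exact hR
  exact hy (measure_mono_null (Set.singleton_subset_iff.2 hyc) h0)

/-- **No bounded clusters, in the raw frame of `stub_minimisingLawsChargeFLC`** (registered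
sub-goal `noDustUnbounded`): every minimising point-stationary hard-core probability law on rooted
configurations of `ℝ³` almost surely has atoms beyond every radius.  Definitional unfolding of
`ae_forall_exists_atom_lt_norm`. [folklore] -/
theorem noDustUnbounded :
    ∀ δ : ℝ, 0 < δ → ∀ P : Measure (Measure (EuclideanSpace ℝ (Fin 3))), IsProbabilityMeasure P →
      (∀ᵐ μ ∂P, (∃ S : Set (EuclideanSpace ℝ (Fin 3)), (0 : EuclideanSpace ℝ (Fin 3)) ∈ S ∧
        (∀ x ∈ S, ∀ y ∈ S, x ≠ y → δ ≤ dist x y) ∧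
        μ = (Measure.count : Measure (EuclideanSpace ℝ (Fin 3))).restrict S)) →
      (∀ g : Measure (EuclideanSpace ℝ (Fin 3)) → EuclideanSpace ℝ (Fin 3) → ENNReal,
        Measurable (Function.uncurry g) →
        ∫⁻ μ, ∫⁻ y, g μ y ∂μ ∂P = ∫⁻ μ, ∫⁻ y, g (Measure.map (fun z => z - y) μ) (-y) ∂μ ∂P) →
      (∫ μ, (∫ y, lennardJones ‖y‖ ∂μ) / 2 ∂P) ≤
        (⨅ Q : PeriodicConfiguration 3, Q.energyPerParticle lennardJones) →
      ∀ᵐ μ ∂P, ∀ R : ℝ, ∃ y : EuclideanSpace ℝ (Fin 3), μ {y} ≠ 0 ∧ R < ‖y‖ := by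
  intro δ hδ P hP hcore hstat hE
  exact ae_forall_exists_atom_lt_norm hδ P hcore hstat hE

end Summit.AtomisticToContinuum.Crystallization.Theorems.HolmgrenBoyleLindGroundStatesChargeFLCEquilibrium.NoDust

end
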